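import Summits.ResolutionOfSingularities.ResolutionOfSingularities.Theorems.FrobeniusClosingSteerToricExitProducer

/-!
# Crux `Steer` (stmt-ResolutionOfSingularities-16345) — K-HW1: the `Concl` certificate on SPECIMEN f♮ (hB₂ʰ's witness class), fibre-wide

OURS (campaign res-hironaka, rung L ★L-G4, slot W4.1; res-L0-w41-idea-3 g10 on res-L0-w41-plan-1 RULING 186d / 187a (P3 «K-HW1») /
194d / 196d «stays OPEN by name for the next W4.1-vocabulary hand»). Theses-free, definition-free;
`--supports stmt-ResolutionOfSingularities-16345 --as helper`, counted 0. NOT a statement of the manuscript under review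
[claim: Hironaka2017, status: under-review]; AI seat, weaker than expert review. Hand proof of record: res-L0-w41-tri-3 g8,
`L/res-L0-w41-tri-3/TRIAGE.md` Row R-Z (204453f0d7e1df04) Z3 (1)–(8), identities checked by `on/concl_witness.py` 655357c21b61d42d.
Pattern of record: res-type-028's specimen-F certificate `…Theorems/FrobeniusClosingSteerToricSpecimenF.lean` (polynomial chart, (T1));
here the chart is a smooth HYPERSURFACE chart, so the producer is (E2) `SteerToricExitCriterion.concl_of_jacobianUnit`
(`…Theorems/FrobeniusClosingSteerToricExitProducer.lean`).

SPECIMEN f♮ (res-type-054 U11, `M₃ = (3,5,3,1)`): `t² = f♮ = u₁u₂²u₃⁴ + u₀³u₁⁶u₂u₃ + u₀³u₁⁵u₂³u₃` over a field `k` of characteristic `2`,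
`u : Fin 4 → K` algebraically independent over `k`, `K = k(u, t)`, `A₀ = k[u]`. Along res-type-054's rational `(1,1)`-member `O♮` of the class
`N_f♮` (`L/res-type-054/U11/MEMBER-CERT-fnatural.md` 4b6f082371e93ab2) the σ_top-steered run of record is legal at all 14 stages of its
period, hence ETERNAL (R-Z (i)), yet the frontier conclusion `Concl O♮ k[u] t` HOLDS (R-Z (ii)) — so `O♮` is a non-vacuity witness of the
frontier binder hB₂ʰ `BirthWanderHighConclTwoN`, not a counter-candidate. THIS FILE is the kernel certificate of R-Z (ii) in its FIBRE-WIDE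
form Z3 (8), uniformly in `O`: for EVERY valuation ring `O ⊇ k[u]` of `K` in which the two kernel letters

  `A = u₀u₂³/u₃`  and  `B = u₁/u₂²`

are UNITS (value `1`; ⟺ the weight of `O` satisfies `v(u₀u₂³) = v(u₃)`, `v(u₁) = v(u₂²)` — a 2-parameter family of rays containing the
whole fibre `N_f♮ ∋ O♮`, every residue structure, rational or not, admissible or not), `Concl O A₀ t` holds for every finitely generated `A₀`
inside the local ring of `k[u]` at the centre of `O` (in particular `A₀ = k[u]`).

Certificate (tri-3 Z3, characteristic 2 used twice). Put `q := t/(u₂²u₃²)`; then `q² = f♮/(u₂u₃)⁴ = B + A³B⁶ + A³B⁵`, so `s := q + 1` has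
`s² = q² + 1 = (1 + B)(1 + A³B⁵)`, and `1 + B ≠ 0 ≠ 1 + A³B⁵` by algebraic independence (`u₂² + u₁ ≠ 0`, `u₂u₃³ + u₀³u₁⁵ ≠ 0`). With
`σ := s/(1 + B)`:
* chart I (`v(σ) ≤ 1`): letters `z = (u₀, u₂, A, B, σ)`, relation `G_I = (1 + Z₃)Z₄² + 1 + Z₂³Z₃⁵` (`(1+B)σ² = 1 + A³B⁵`), Jacobian unit
  `∂₂G_I(z) = 3A²B⁵ = A²B⁵`;
* chart II (`v(σ) > 1`, so `σ' := σ⁻¹ = s/(1 + A³B⁵)` has `v(σ') < 1`): letters `z = (u₀, u₂, A, B, σ')`, relation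
  `G_II = (1 + Z₂³Z₃⁵)Z₄² + 1 + Z₃`, Jacobian unit `∂₃G_II(z) = 5A³B⁴σ'² + 1` (value `1` because `v(σ') < 1`).
In both charts `u₁ = Bu₂²`, `u₃ = u₀u₂³A⁻¹`, `s ∈ k[z]` and `t = (s + 1)u₂²u₃²` lie in the local ring `locAtCentre k[z] O`, `k(z) = K`, and
`trdeg_k K = 4` (`u` is a transcendence basis: `t` is algebraic over `k[u]`, `K = k(u,t)` — verbatim the specimen-F argument), so (E2) gives
`Concl`: the model `k[z, gens A₀, t] ⊆ O` is finitely generated with fraction field `K` and its local ring at the centre of `O` is the regular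
`locAtCentre k[z] O` (the hypersurface `G = 0` is smooth over `k` there). NOT formalised here: `O♮` itself, the legality/eternity of its run
(R-Z (i), Z1–Z2) and the other clauses of hB₂ʰ (Z4) — only the `Concl` conjunct, which is the positive kernel target K-HW1. [folklore]
-/

noncomputable section

-- single-problem summit: the doubled namespace component `ResolutionOfSingularities` is forced
set_option linter.dupNamespace false

open scoped BigOperators

namespace Summit.ResolutionOfSingularities.ResolutionOfSingularities.Theorems.SteerHighBirthWitness

open Summit.ResolutionOfSingularities.ResolutionOfSingularities.Theorems.SwitchingDichotomy.Words (Concl)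
open Literature.AlgebraicGeometry.Resolution
open MvPolynomial

variable {k K : Type} [Field k] [Field K] [Algebra k K]

/-! ## §1 Field identities on the specimen (no characteristic hypothesis except where stated) -/

section Identities

variable (u : Fin 4 → K) (t : K) (hu0 : ∀ i, u i ≠ 0)
include hu0

/-- `q² = f♮/(u₂u₃)⁴ = B + A³B⁶ + A³B⁵` for `q = t/(u₂²u₃²)`, `A = u₀u₂³/u₃`, `B = u₁/u₂²` (uses only `t² = f♮`). [folklore] -/
theorem q_sq_eq (ht : t ^ 2 = u 1 * u 2 ^ 2 * u 3 ^ 4 + u 0 ^ 3 * u 1 ^ 6 * u 2 * u 3 + u 0 ^ 3 * u 1 ^ 5 * u 2 ^ 3 * u 3) :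
    (t / (u 2 ^ 2 * u 3 ^ 2)) ^ 2 = u 1 / u 2 ^ 2 + (u 0 * u 2 ^ 3 / u 3) ^ 3 * (u 1 / u 2 ^ 2) ^ 6 +
      (u 0 * u 2 ^ 3 / u 3) ^ 3 * (u 1 / u 2 ^ 2) ^ 5 := by
  have := hu0 0; have := hu0 1; have := hu0 2; have := hu0 3
  rw [div_pow, ht]
  field_simp

/-- `u₁ = B·u₂²`. [folklore] -/
theorem u1_eq : u 1 = u 1 / u 2 ^ 2 * u 2 ^ 2 := by
  have := hu0 2
  field_simp

/-- `u₃ = u₀u₂³·A⁻¹`. [folklore] -/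
theorem u3_eq : u 3 = u 0 * u 2 ^ 3 * (u 0 * u 2 ^ 3 / u 3)⁻¹ := by
  have := hu0 0; have := hu0 2; have := hu0 3
  field_simp

/-- `t = q·u₂²u₃²`. [folklore] -/
theorem t_eq : t = t / (u 2 ^ 2 * u 3 ^ 2) * (u 2 ^ 2 * u 3 ^ 2) := by
  have := hu0 2; have := hu0 3
  field_simp

/-- `1 + A³B⁵ = (u₂u₃³ + u₀³u₁⁵)/(u₂u₃³)`. [folklore] -/
theorem one_add_cube_mul_eq : 1 + (u 0 * u 2 ^ 3 / u 3) ^ 3 * (u 1 / u 2 ^ 2) ^ 5 =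
    (u 2 * u 3 ^ 3 + u 0 ^ 3 * u 1 ^ 5) / (u 2 * u 3 ^ 3) := by
  have := hu0 0; have := hu0 1; have := hu0 2; have := hu0 3
  field_simp

/-- `1 + B = (u₂² + u₁)/u₂²`. [folklore] -/
theorem one_add_eq : 1 + u 1 / u 2 ^ 2 = (u 2 ^ 2 + u 1) / u 2 ^ 2 := by
  have := hu0 2
  field_simp

end Identities

/-! ## §2 Two non-vanishings from algebraic independence, and `trdeg_k K = 4` -/

/-- `u₂² + u₁ ≠ 0` (the polynomial `X₂² + X₁` takes the value `1` at `e₁`). [folklore] -/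
theorem sq_add_ne_zero (u : Fin 4 → K) (hu : AlgebraicIndependent k u) : u 2 ^ 2 + u 1 ≠ 0 := by
  intro h
  have h1 : MvPolynomial.aeval u (X 2 ^ 2 + X 1 : MvPolynomial (Fin 4) k) = 0 := by
    simp only [map_add, map_pow, aeval_X]; exact h
  have h2 := (algebraicIndependent_iff.mp hu) _ h1
  have h3 := congr_arg (MvPolynomial.eval (fun i : Fin 4 => if i = 1 then (1 : k) else 0)) h2
  simp at h3

/-- `u₂u₃³ + u₀³u₁⁵ ≠ 0` (the polynomial `X₂X₃³ + X₀³X₁⁵` takes the value `1` at `e₂ + e₃`). [folklore] -/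
theorem mono_add_ne_zero (u : Fin 4 → K) (hu : AlgebraicIndependent k u) : u 2 * u 3 ^ 3 + u 0 ^ 3 * u 1 ^ 5 ≠ 0 := by
  intro h
  have h1 : MvPolynomial.aeval u (X 2 * X 3 ^ 3 + X 0 ^ 3 * X 1 ^ 5 : MvPolynomial (Fin 4) k) = 0 := by
    simp only [map_add, map_mul, map_pow, aeval_X]; exact h
  have h2 := (algebraicIndependent_iff.mp hu) _ h1
  have h3 := congr_arg (MvPolynomial.eval (fun i : Fin 4 => if i = 2 ∨ i = 3 then (1 : k) else 0)) h2
  simp at h3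

/-- `trdeg_k K = 4`: `u` is a transcendence basis of `K = k(u, t)` since `t² = f♮ ∈ k[u]` (verbatim the specimen-F argument). [folklore] -/
theorem cardinalMk_eq_trdeg (u : Fin 4 → K) (hu : AlgebraicIndependent k u) (t : K)
    (ht : t ^ 2 = u 1 * u 2 ^ 2 * u 3 ^ 4 + u 0 ^ 3 * u 1 ^ 6 * u 2 * u 3 + u 0 ^ 3 * u 1 ^ 5 * u 2 ^ 3 * u 3)
    (hK : IntermediateField.adjoin k (insert t (Set.range u)) = ⊤) :
    Cardinal.mk (Fin 4) = Algebra.trdeg k K := by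
  classical
  have htop : ∀ x : K, x ∈ IntermediateField.adjoin k (insert t (Set.range u)) := fun x => by
    rw [hK]; exact IntermediateField.mem_top
  have halg : Algebra.IsAlgebraic (Algebra.adjoin k (Set.range u)) K := by
    let T : Subfield K :=
      { (Subalgebra.algebraicClosure (Algebra.adjoin k (Set.range u)) K).toSubring with
        inv_mem' := fun x hx => IsAlgebraic.inv hx }
    have hT : ∀ x : K, x ∈ T ↔ IsAlgebraic (Algebra.adjoin k (Set.range u)) x := fun x => Iff.rfl
    have hfu : u 1 * u 2 ^ 2 * u 3 ^ 4 + u 0 ^ 3 * u 1 ^ 6 * u 2 * u 3 + u 0 ^ 3 * u 1 ^ 5 * u 2 ^ 3 * u 3 ∈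
        Algebra.adjoin k (Set.range u) := by
      have h : ∀ i, u i ∈ Algebra.adjoin k (Set.range u) := fun i => Algebra.subset_adjoin (Set.mem_range_self i)
      refine Subalgebra.add_mem _ (Subalgebra.add_mem _ ?_ ?_) ?_
      · exact Subalgebra.mul_mem _ (Subalgebra.mul_mem _ (h 1) (Subalgebra.pow_mem _ (h 2) 2)) (Subalgebra.pow_mem _ (h 3) 4)
      · exact Subalgebra.mul_mem _ (Subalgebra.mul_mem _ (Subalgebra.mul_mem _ (Subalgebra.pow_mem _ (h 0) 3)
          (Subalgebra.pow_mem _ (h 1) 6)) (h 2)) (h 3)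
      · exact Subalgebra.mul_mem _ (Subalgebra.mul_mem _ (Subalgebra.mul_mem _ (Subalgebra.pow_mem _ (h 0) 3)
          (Subalgebra.pow_mem _ (h 1) 5)) (Subalgebra.pow_mem _ (h 2) 3)) (h 3)
    have hgen : (IntermediateField.adjoin k (insert t (Set.range u))).toSubfield ≤ T := by
      rw [IntermediateField.adjoin_toSubfield]
      refine Subfield.closure_le.mpr ?_
      rintro x (⟨c, rfl⟩ | rfl | ⟨i, rfl⟩)
      · rw [SetLike.mem_coe, hT, IsScalarTower.algebraMap_apply k (Algebra.adjoin k (Set.range u)) K c]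
        exact isAlgebraic_algebraMap _
      · rw [SetLike.mem_coe, hT]
        refine ⟨Polynomial.X ^ 2 - Polynomial.C ⟨_, hfu⟩, Polynomial.X_pow_sub_C_ne_zero two_pos _, ?_⟩
        rw [map_sub, map_pow, Polynomial.aeval_X, Polynomial.aeval_C, ht]
        exact sub_self _
      · rw [SetLike.mem_coe, hT]
        exact isAlgebraic_algebraMap (⟨u i, Algebra.subset_adjoin ⟨i, rfl⟩⟩ : Algebra.adjoin k (Set.range u))
    exact ⟨fun x => (hT x).mp (hgen ((IntermediateField.mem_toSubfield _ _).mpr (htop x)))⟩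
  have hbasis : IsTranscendenceBasis k u := (AlgebraicIndependent.isTranscendenceBasis_iff_isAlgebraic hu).mpr halg
  exact hbasis.cardinalMk_eq_trdeg

/-! ## §3 The kernel certificate -/

/-- **K-HW1 — SPECIMEN f♮: `Concl O A₀ t` ON THE WHOLE UNIT FIBRE `v(A) = v(B) = 0`, uniformly in `O`.** `k ⊆ K` of characteristic `2`,
`u : Fin 4 → K` algebraically independent over `k`, `t² = u₁u₂²u₃⁴ + u₀³u₁⁶u₂u₃ + u₀³u₁⁵u₂³u₃`, `K = k(u, t)`. For every valuation ring
`O ⊇ k[u]` of `K` in which `A = u₀u₂³/u₃` and `B = u₁/u₂²` are units (value `1`) — in particular along res-type-054's `O♮` and every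
member of the class `N_f♮` — and every finitely generated `A₀` inside the local ring of `k[u]` at the centre of `O`, the frontier conclusion
`Concl O A₀ t` holds: by the two-chart hypersurface atlas `{k[u₀,u₂,A,B,σ], k[u₀,u₂,A,B,σ⁻¹]}`, `σ = (t/(u₂²u₃²) + 1)/(1 + B)`, relations
`(1+B)σ² = 1 + A³B⁵` resp. `(1+A³B⁵)σ'² = 1 + B` with Jacobian units `A²B⁵` resp. `5A³B⁴σ'² + 1`, and the producer (E2)
`SteerToricExitCriterion.concl_of_jacobianUnit` (res-L0-w41-tri-3 TRIAGE Row R-Z, Z3). OURS. [folklore] -/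
theorem fNatural_concl_of_units [CharP K 2] (u : Fin 4 → K) (hu : AlgebraicIndependent k u) (t : K)
    (ht : t ^ 2 = u 1 * u 2 ^ 2 * u 3 ^ 4 + u 0 ^ 3 * u 1 ^ 6 * u 2 * u 3 + u 0 ^ 3 * u 1 ^ 5 * u 2 ^ 3 * u 3)
    (hK : IntermediateField.adjoin k (insert t (Set.range u)) = ⊤)
    (O : ValuationSubring K) (hk : ∀ c : k, algebraMap k K c ∈ O) (huO : ∀ i, u i ∈ O)
    (hA : O.valuation (u 0 * u 2 ^ 3 / u 3) = 1) (hB : O.valuation (u 1 / u 2 ^ 2) = 1)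
    (A₀ : Subalgebra k K) (hA₀ : A₀.FG)
    (hA₀L : A₀.toSubring ≤ locAtCentre (Algebra.adjoin k (Set.range u)).toSubring O) :
    Concl O A₀ t := by
  classical
  have hu0 : ∀ i, u i ≠ 0 := fun i => hu.ne_zero i
  have h2 : (2 : K) = 0 := CharTwo.two_eq_zero
  have htr : Algebra.trdeg k K = (4 : ℕ) := by
    rw [← cardinalMk_eq_trdeg u hu t ht hK]; simp
  -- the letters
  set A : K := u 0 * u 2 ^ 3 / u 3 with hAdef
  set B : K := u 1 / u 2 ^ 2 with hBdef
  set q : K := t / (u 2 ^ 2 * u 3 ^ 2) with hqdef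
  set s : K := q + 1 with hsdef
  have hA0 : A ≠ 0 := ne_zero_of_valuation_eq_one hA
  have hB0 : B ≠ 0 := ne_zero_of_valuation_eq_one hB
  have hβ : (1 + B) ≠ 0 := by
    rw [hBdef, one_add_eq u (hu0 := hu0)]
    exact div_ne_zero (sq_add_ne_zero u hu) (pow_ne_zero _ (hu0 2))
  have hα : (1 + A ^ 3 * B ^ 5) ≠ 0 := by
    rw [hAdef, hBdef, one_add_cube_mul_eq u (hu0 := hu0)]
    exact div_ne_zero (mono_add_ne_zero u hu) (mul_ne_zero (hu0 2) (pow_ne_zero _ (hu0 3)))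
  -- `s² = (1 + B)(1 + A³B⁵)` (characteristic 2)
  have hq2 : q ^ 2 = B + A ^ 3 * B ^ 6 + A ^ 3 * B ^ 5 := q_sq_eq u t hu0 ht
  have hs2 : s ^ 2 = (1 + B) * (1 + A ^ 3 * B ^ 5) := by
    have : s ^ 2 = q ^ 2 + 1 := by rw [hsdef]; linear_combination q * h2
    rw [this, hq2]; ring
  have hs0 : s ≠ 0 := by
    intro h; rw [h, zero_pow two_ne_zero] at hs2; exact mul_ne_zero hβ hα hs2.symm
  -- the letters `u₁, u₃, t` in terms of `A, B, s`
  have hu1 : u 1 = B * u 2 ^ 2 := u1_eq u hu0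
  have hu3 : u 3 = u 0 * u 2 ^ 3 * A⁻¹ := u3_eq u hu0
  have htq : t = (s - 1) * (u 2 ^ 2 * u 3 ^ 2) := by
    have : q = s - 1 := by rw [hsdef]; ring
    rw [← this]; exact t_eq u t hu0
  -- ### the common part of both charts: given the fifth letter `c ∈ O` with `s ∈ k[u₀,u₂,A,B,c]`, a relation and a Jacobian unit
  have chart : ∀ (c : K), c ∈ O → (∀ Bz : Subalgebra k K, u 0 ∈ Bz → u 2 ∈ Bz → A ∈ Bz → B ∈ Bz → c ∈ Bz → s ∈ Bz) →
      ∀ G : MvPolynomial (Fin 5) k, MvPolynomial.aeval ![u 0, u 2, A, B, c] G = 0 →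
      (∃ j, O.valuation (MvPolynomial.aeval ![u 0, u 2, A, B, c] (MvPolynomial.pderiv j G)) = 1) →
      Concl O A₀ t := by
    intro c hcO hsc G hG hJ
    set z : Fin 5 → K := ![u 0, u 2, A, B, c] with hzdef
    have ez0 : z 0 = u 0 := rfl
    have ez1 : z 1 = u 2 := rfl
    have ez2 : z 2 = A := rfl
    have ez3 : z 3 = B := rfl
    have ez4 : z 4 = c := rfl
    have hzO : ∀ j, z j ∈ O := by
      intro j; fin_cases j
      · exact huO 0
      · exact huO 2
      · exact (O.valuation_le_one_iff _).mp hA.le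
      · exact (O.valuation_le_one_iff _).mp hB.le
      · exact hcO
    set Bz : Subalgebra k K := Algebra.adjoin k (Set.range z) with hBzdef
    have hzB : ∀ j, z j ∈ Bz := fun j => Algebra.subset_adjoin (Set.mem_range_self j)
    have hu0B : u 0 ∈ Bz := ez0 ▸ hzB 0
    have hu2B : u 2 ∈ Bz := ez1 ▸ hzB 1
    have hAB : A ∈ Bz := ez2 ▸ hzB 2
    have hBB : B ∈ Bz := ez3 ▸ hzB 3
    have hcB : c ∈ Bz := ez4 ▸ hzB 4
    have hsB : s ∈ Bz := hsc Bz hu0B hu2B hAB hBB hcB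
    have hu1B : u 1 ∈ Bz := by rw [hu1]; exact Bz.mul_mem hBB (Bz.pow_mem hu2B 2)
    -- the local ring `L = locAtCentre k[z] O` contains `A⁻¹`, hence `u₃` and `t`
    set L : Subring K := locAtCentre Bz.toSubring O with hLdef
    have hBL : Bz.toSubring ≤ L := le_locAtCentre _ O
    have hAinvL : A⁻¹ ∈ L := inv_mem_locAtCentre (hBL hAB) hA
    have hu3L : u 3 ∈ L := by
      rw [hu3]; exact L.mul_mem (L.mul_mem (hBL hu0B) (L.pow_mem (hBL hu2B) 3)) hAinvL
    have htL : t ∈ L := by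
      rw [htq]
      exact L.mul_mem (L.sub_mem (hBL hsB) L.one_mem) (L.mul_mem (L.pow_mem (hBL hu2B) 2) (L.pow_mem hu3L 2))
    have huL : ∀ i, u i ∈ L := by
      intro i; fin_cases i
      · exact hBL hu0B
      · exact hBL hu1B
      · exact hBL hu2B
      · exact hu3L
    -- `k(z) = K`
    have hzK : IntermediateField.adjoin k (Set.range z) = ⊤ := by
      refine eq_top_iff.mpr ?_
      rw [← hK]
      refine IntermediateField.adjoin_le_iff.mpr ?_
      have hBF : ∀ x, x ∈ Bz → x ∈ IntermediateField.adjoin k (Set.range z) := fun x hx =>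
        IntermediateField.algebra_adjoin_le_adjoin k _ hx
      have hu3F : u 3 ∈ IntermediateField.adjoin k (Set.range z) := by
        rw [hu3]; exact mul_mem (mul_mem (hBF _ hu0B) (pow_mem (hBF _ hu2B) 3)) (inv_mem (hBF _ hAB))
      rintro x (hx | ⟨i, rfl⟩)
      · rw [hx, SetLike.mem_coe, htq]
        exact mul_mem (sub_mem (hBF _ hsB) (one_mem _)) (mul_mem (pow_mem (hBF _ hu2B) 2) (pow_mem hu3F 2))
      · rw [SetLike.mem_coe]
        fin_cases i
        · exact hBF _ hu0B
        · exact hBF _ hu1B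
        · exact hBF _ hu2B
        · exact hu3F
    -- `A₀ ≤ locAtCentre k[u] O ≤ L`
    have huL' : (Algebra.adjoin k (Set.range u)).toSubring ≤ L :=
      SteerToricConcl.adjoin_toSubring_le_locAtCentre O Bz (Set.range_subset_iff.mpr huL)
    have hA₀L' : A₀.toSubring ≤ L := by
      refine hA₀L.trans ?_
      have h1 := locAtCentre_mono O huL'
      rw [hLdef, locAtCentre_locAtCentre] at h1
      rw [hLdef]
      exact h1
    exact SteerToricExitCriterion.concl_of_jacobianUnit O hk z hzO hzK htr G hG hJ A₀ hA₀ hA₀L' t htL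
  -- ### the dichotomy `v(σ) ≤ 1` / `v(σ) > 1`, `σ = s/(1+B)`
  set σ : K := s / (1 + B) with hσdef
  have hσ0 : σ ≠ 0 := div_ne_zero hs0 hβ
  have hβσ : (1 + B) * σ = s := by rw [hσdef]; field_simp
  have hrelI : (1 + B) * σ ^ 2 = 1 + A ^ 3 * B ^ 5 := by
    have : (1 + B) * ((1 + B) * σ ^ 2) = (1 + B) * (1 + A ^ 3 * B ^ 5) := by
      rw [← hs2, ← hβσ]; ring
    exact mul_left_cancel₀ hβ this
  by_cases hσO : O.valuation σ ≤ 1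
  · -- chart I: `z = (u₀, u₂, A, B, σ)`, `G_I = (1 + Z₃)Z₄² + 1 + Z₂³Z₃⁵`, unit `∂₂G_I = 3A²B⁵`
    have e2 : (![u 0, u 2, A, B, σ] : Fin 5 → K) 2 = A := rfl
    have e3 : (![u 0, u 2, A, B, σ] : Fin 5 → K) 3 = B := rfl
    have e4 : (![u 0, u 2, A, B, σ] : Fin 5 → K) 4 = σ := rfl
    refine chart σ ((O.valuation_le_one_iff _).mp hσO) ?_ ((1 + X 3) * X 4 ^ 2 + 1 + X 2 ^ 3 * X 3 ^ 5) ?_ ⟨2, ?_⟩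
    · intro Bz _ _ _ hBB hcB
      rw [← hβσ]; exact Bz.mul_mem (Bz.add_mem Bz.one_mem hBB) hcB
    · simp only [map_add, map_mul, map_pow, map_one, aeval_X, e2, e3, e4]
      linear_combination hrelI + (1 + A ^ 3 * B ^ 5) * h2
    · have hd : MvPolynomial.pderiv 2 ((1 + X 3) * X 4 ^ 2 + 1 + X 2 ^ 3 * X 3 ^ 5 : MvPolynomial (Fin 5) k) =
          3 * X 2 ^ 2 * X 3 ^ 5 := by
        simp only [map_add, pderiv_mul, pderiv_pow, pderiv_one, pderiv_X_self,
          pderiv_X_of_ne (show (3 : Fin 5) ≠ 2 by decide), pderiv_X_of_ne (show (4 : Fin 5) ≠ 2 by decide)]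
        ring
      have hval : MvPolynomial.aeval ![u 0, u 2, A, B, σ]
          (MvPolynomial.pderiv 2 ((1 + X 3) * X 4 ^ 2 + 1 + X 2 ^ 3 * X 3 ^ 5 : MvPolynomial (Fin 5) k)) =
          3 * A ^ 2 * B ^ 5 := by
        rw [hd]; simp only [map_mul, map_pow, map_ofNat, aeval_X, e2, e3]
      have h3 : (3 : K) = 1 := by linear_combination h2
      rw [hval, h3, one_mul, map_mul, map_pow, map_pow, hA, hB, one_pow, one_pow, one_mul]
  · -- chart II: `σ' = σ⁻¹ = s/(1 + A³B⁵)`, `v(σ') < 1`; `z = (u₀, u₂, A, B, σ')`, `G_II = (1 + Z₂³Z₃⁵)Z₄² + 1 + Z₃`,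
    -- unit `∂₃G_II(z) = 5A³B⁴σ'² + 1`
    have hσ' : O.valuation σ⁻¹ < 1 := by
      rw [map_inv₀]; exact inv_lt_one_of_one_lt₀ (lt_of_not_ge hσO)
    have hασ' : (1 + A ^ 3 * B ^ 5) * σ⁻¹ = s := by
      rw [← hrelI, ← hβσ]; field_simp
    have hrelII : (1 + A ^ 3 * B ^ 5) * σ⁻¹ ^ 2 = 1 + B := by
      rw [← hrelI]; field_simp
    have e2 : (![u 0, u 2, A, B, σ⁻¹] : Fin 5 → K) 2 = A := rfl
    have e3 : (![u 0, u 2, A, B, σ⁻¹] : Fin 5 → K) 3 = B := rfl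
    have e4 : (![u 0, u 2, A, B, σ⁻¹] : Fin 5 → K) 4 = σ⁻¹ := rfl
    refine chart σ⁻¹ ((O.valuation_le_one_iff _).mp hσ'.le) ?_ ((1 + X 2 ^ 3 * X 3 ^ 5) * X 4 ^ 2 + 1 + X 3) ?_ ⟨3, ?_⟩
    · intro Bz _ _ hAB hBB hcB
      rw [← hασ']
      exact Bz.mul_mem (Bz.add_mem Bz.one_mem (Bz.mul_mem (Bz.pow_mem hAB 3) (Bz.pow_mem hBB 5))) hcB
    · simp only [map_add, map_mul, map_pow, map_one, aeval_X, e2, e3, e4]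
      linear_combination hrelII + (1 + B) * h2
    · have hd : MvPolynomial.pderiv 3 ((1 + X 2 ^ 3 * X 3 ^ 5) * X 4 ^ 2 + 1 + X 3 : MvPolynomial (Fin 5) k) =
          5 * X 2 ^ 3 * X 3 ^ 4 * X 4 ^ 2 + 1 := by
        simp only [map_add, pderiv_mul, pderiv_pow, pderiv_one, pderiv_X_self,
          pderiv_X_of_ne (show (2 : Fin 5) ≠ 3 by decide), pderiv_X_of_ne (show (4 : Fin 5) ≠ 3 by decide)]
        ring
      have hval : MvPolynomial.aeval ![u 0, u 2, A, B, σ⁻¹]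
          (MvPolynomial.pderiv 3 ((1 + X 2 ^ 3 * X 3 ^ 5) * X 4 ^ 2 + 1 + X 3 : MvPolynomial (Fin 5) k)) =
          5 * A ^ 3 * B ^ 4 * σ⁻¹ ^ 2 + 1 := by
        rw [hd]; simp only [map_add, map_mul, map_pow, map_ofNat, map_one, aeval_X, e2, e3, e4]
      have h5 : (5 : K) = 1 := by linear_combination 2 * h2
      rw [hval, h5, one_mul, add_comm]
      refine Valuation.map_one_add_of_lt _ ?_
      rw [map_mul, map_mul, map_pow, map_pow, map_pow, hA, hB, one_pow, one_pow, one_mul, one_mul]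
      exact pow_lt_one₀ zero_le hσ' two_ne_zero

/-- **K-HW1, the datum of record (`A₀ = k[u]`).** Same hypotheses; `Concl O k[u] t` — the form in which res-L0-w41-tri-3 Row R-Z (ii) states it
for `O♮` (`A₀ = 𝔽₂[u]`, `t = t♮`). OURS. [folklore] -/
theorem fNatural_concl [CharP K 2] (u : Fin 4 → K) (hu : AlgebraicIndependent k u) (t : K)
    (ht : t ^ 2 = u 1 * u 2 ^ 2 * u 3 ^ 4 + u 0 ^ 3 * u 1 ^ 6 * u 2 * u 3 + u 0 ^ 3 * u 1 ^ 5 * u 2 ^ 3 * u 3)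
    (hK : IntermediateField.adjoin k (insert t (Set.range u)) = ⊤)
    (O : ValuationSubring K) (hk : ∀ c : k, algebraMap k K c ∈ O) (huO : ∀ i, u i ∈ O)
    (hA : O.valuation (u 0 * u 2 ^ 3 / u 3) = 1) (hB : O.valuation (u 1 / u 2 ^ 2) = 1) :
    Concl O (Algebra.adjoin k (Set.range u)) t := by
  classical
  refine fNatural_concl_of_units u hu t ht hK O hk huO hA hB _ ?_ (le_locAtCentre _ O)
  refine ⟨Finset.univ.image u, ?_⟩
  rw [Finset.coe_image, Finset.coe_univ, Set.image_univ]

end Summit.ResolutionOfSingularities.ResolutionOfSingularities.Theorems.SteerHighBirthWitness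

end
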